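import Literature.NumberTheory.Transcendental.RoySmallValueStep1
import Literature.NumberTheory.Transcendental.RoySmallValueCoprimeQ
import Literature.NumberTheory.Transcendental.RoySmallValueFactorization
import Literature.NumberTheory.Transcendental.RoySmallValueOrbitsK
import HarnessLib

/-!
# Roy's small value estimate for `𝔾ₐ × 𝔾ₘ` — the data attached to one degree (`P̃_D`, `Q_D`, `𝒵(P̃_D, Q_D)`, `Φ`)

Topic `Literature/NumberTheory/Transcendental`. Part of the formalisation of the proof of Roy 2013,
Theorem 1.1 (named fact `roy2013_thm_1_1`, `RoySmallValueEstimates.lean`). Source: D. Roy,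
*A small value estimate for `𝔾ₐ × 𝔾ₘ`*, Mathematika 59 (2013) 333–363 = arXiv:1301.0663, §6
(proof of Proposition 6.4) and §7 (pp. 17–19 of the arXiv text):

> [...] there exist integers `a₁, …, a_D` of absolute values at most `D` such that
> `Q = ∑ aᵢ 𝒟ⁱP` is relatively prime to `P`. Then `𝒵(P, Q)` has dimension `0` [...] choose a system
> of representatives `α₁, …, α_t` of [...] `𝒵(P,Q)(ℂ)`. Then, there exist `a ∈ ℂ^×` and
> `e₁, …, e_t ∈ ℕ*` such that `F(R) = a R(α₁)^{e₁} ⋯ R(α_t)^{e_t}` [...]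

For an integer form `P̃` of degree `D ≥ 1` not divisible by `X₀` nor by `X₂` (the `P̃_D` of §7,
Step 1) this file ASSEMBLES the objects the proof attaches to it: the coprime companion
`Q = ∑_{i=1}^{D} tⁱ 𝒟ⁱP̃ ∈ ℤ[X]_D` (`levelQ`, from `exists_coprime_deriv_combination` of the tree,
seat B), the data `(M₁, M₂, σ)` of the determinant `Φ` with `#M₂ = D²` (`exists_phi_data`,
`card_eq_sq`), the NORMALISED system of representatives of `𝒵(P̃, Q)(ℂ)`
(`exists_common_zero_reprs` + `exists_normalised`), the algebraicity of their coordinates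
(`isAlgebraic_ratio_of_common_zero`), and the factorisation `Φ(P̃, Q, ·) = c ∏ ℓ_{α_j}^{e_j}` with
exact multiplicities (`royF_eq_C_mul_prod`) — bundled in the record `LevelPkg D P̃`, shown to be
inhabited (`nonempty_levelPkg`), together with the `ZeroConfigK` it induces over any normal number
field containing the coordinates (`LevelPkg.cfg`). Everything is proved; the definitions have
bodies; no named facts.

## References

* [Roy2013] D. Roy, *A small value estimate for 𝔾ₐ × 𝔾ₘ*, Mathematika 59 (2013), 333–363
  (arXiv:1301.0663), §6 (proof of Proposition 6.4) and §7, Steps 1–3.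
-/

noncomputable section

open MvPolynomial Finset

namespace Literature.NumberTheory.Transcendental

namespace Roy2013

/-! ### The companion form `Q` -/

/-- **`Q = ∑_{i=1}^{D} tⁱ 𝒟ⁱP̃ ∈ ℤ[X]_D`.** [cite: Roy2013, §6, proof of Prop. 6.4] -/
def levelQ (D : ℕ) (Pt : MvPolynomial (Fin 3) ℤ) (t : ℕ) : MvPolynomial (Fin 3) ℤ :=
  ∑ i ∈ Icc 1 D, ((t : ℤ) ^ i) • (homDK ℤ)^[i] Pt

/-- Its complexification. [folklore] -/
theorem map_levelQ (D : ℕ) (Pt : MvPolynomial (Fin 3) ℤ) (t : ℕ) :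
    map (Int.castRingHom ℂ) (levelQ D Pt t) =
      ∑ i ∈ Icc 1 D, ((t : ℂ) ^ i) • homD^[i] (map (Int.castRingHom ℂ) Pt) := by
  rw [levelQ, map_sum]
  refine Finset.sum_congr rfl fun i _ => ?_
  rw [map_zsmul, map_iterate_homDK, ← Int.cast_smul_eq_zsmul ℂ]
  push_cast
  rfl

/-- `Q` is a form of degree `D` (over `ℂ`). [folklore] -/
theorem isHomogeneous_map_levelQ {Pt : MvPolynomial (Fin 3) ℤ} {D : ℕ}
    (hPt : (map (Int.castRingHom ℂ) Pt).IsHomogeneous D) (t : ℕ) :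
    (map (Int.castRingHom ℂ) (levelQ D Pt t)).IsHomogeneous D := by
  rw [map_levelQ]
  refine IsHomogeneous.sum _ _ _ fun i _ => ?_
  rw [smul_eq_C_mul]
  simpa using (isHomogeneous_C (Fin 3) ((t : ℂ) ^ i)).mul (isHomogeneous_iterate_homD hPt i)

/-- Rational and complex versions of an integer form. [folklore] -/
theorem toCX_map_int (Pz : MvPolynomial (Fin 3) ℤ) :
    toCX (map (Int.castRingHom ℚ) Pz) = map (Int.castRingHom ℂ) Pz := by
  rw [toCX_apply, MvPolynomial.map_map,
    RingHom.ext_int ((algebraMap ℚ ℂ).comp (Int.castRingHom ℚ)) (Int.castRingHom ℂ)]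

/-- Homogeneity descends to the rational version. [folklore] -/
theorem isHomogeneous_map_rat {Pz : MvPolynomial (Fin 3) ℤ} {D : ℕ}
    (h : (map (Int.castRingHom ℂ) Pz).IsHomogeneous D) : (map (Int.castRingHom ℚ) Pz).IsHomogeneous D := by
  intro d hd
  apply h
  rw [coeff_map] at hd ⊢
  intro h0
  apply hd
  have h1 : ((coeff d Pz : ℤ) : ℂ) = 0 := h0
  have h2 : (coeff d Pz : ℤ) = 0 := by exact_mod_cast h1
  change (Int.castRingHom ℚ) (coeff d Pz) = 0
  rw [h2, map_zero]

/-! ### `#M₂ = D²` -/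

/-- A monomial complement `M₂` of `(P, Q)_{2D}` in `ℂ[X]_{2D}` has `D²` elements.
[cite: Roy2013, §5, proof of Theorem 5.2 ("`dim_ℂ E₂ = D²`")] -/
theorem card_eq_sq {P Q : CX} {D : ℕ} (hP : P.IsHomogeneous D) (hQ : Q.IsHomogeneous D)
    (hP0 : P ≠ 0) (hQ0 : Q ≠ 0)
    (hPQ : ∀ f : CX, Q * f ∈ Ideal.span {P} → f ∈ Ideal.span {P}) {M₂ : Finset (Fin 3 →₀ ℕ)}
    (hE₂i : Submodule.span ℂ ((fun μ => monomial μ (1 : ℂ)) '' (M₂ : Set (Fin 3 →₀ ℕ))) ⊓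
      ((homogeneousSubmodule (Fin 3) ℂ D).map (LinearMap.mulLeft ℂ P) ⊔
        (homogeneousSubmodule (Fin 3) ℂ D).map (LinearMap.mulLeft ℂ Q)) = ⊥)
    (hE₂s : Submodule.span ℂ ((fun μ => monomial μ (1 : ℂ)) '' (M₂ : Set (Fin 3 →₀ ℕ))) ⊔
      ((homogeneousSubmodule (Fin 3) ℂ D).map (LinearMap.mulLeft ℂ P) ⊔
        (homogeneousSubmodule (Fin 3) ℂ D).map (LinearMap.mulLeft ℂ Q)) =
      homogeneousSubmodule (Fin 3) ℂ (2 * D)) :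
    M₂.card = D ^ 2 := by
  haveI := NguyenRoy.finiteDimensional_homogeneousSubmodule (K := ℂ) (σ := Fin 3) D
  haveI := NguyenRoy.finiteDimensional_homogeneousSubmodule (K := ℂ) (σ := Fin 3) (2 * D)
  haveI : FiniteDimensional ℂ
      (Submodule.span ℂ ((fun μ => monomial μ (1 : ℂ)) '' (M₂ : Set (Fin 3 →₀ ℕ)))) :=
    FiniteDimensional.span_of_finite ℂ (Set.toFinite _)
  have h1 := Submodule.finrank_sup_add_finrank_inf_eq
    (Submodule.span ℂ ((fun μ => monomial μ (1 : ℂ)) '' (M₂ : Set (Fin 3 →₀ ℕ))))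
    ((homogeneousSubmodule (Fin 3) ℂ D).map (LinearMap.mulLeft ℂ P) ⊔
      (homogeneousSubmodule (Fin 3) ℂ D).map (LinearMap.mulLeft ℂ Q))
  rw [hE₂i, finrank_bot, add_zero, hE₂s, finrank_homogeneousSubmodule_fin_three,
    finrank_span_monomials] at h1
  have h3 : ∀ n, n = D → Module.finrank ℂ ↥((homogeneousSubmodule (Fin 3) ℂ n).map
      (LinearMap.mulLeft ℂ P) ⊔ (homogeneousSubmodule (Fin 3) ℂ n).map (LinearMap.mulLeft ℂ Q)) +
        D ^ 2 = (2 * D + 2).choose 2 := by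
    intro n hn
    have h4 := finrank_map_sup_map_add_sq hP hQ hP0 hQ0 hPQ 0
    obtain rfl : n = 0 + D := by omega
    simpa using h4
  have h2 := h3 D rfl
  have h9 : M₂.card + Module.finrank ℂ ↥((homogeneousSubmodule (Fin 3) ℂ D).map
      (LinearMap.mulLeft ℂ P) ⊔ (homogeneousSubmodule (Fin 3) ℂ D).map (LinearMap.mulLeft ℂ Q)) =
      Module.finrank ℂ ↥((homogeneousSubmodule (Fin 3) ℂ D).map
      (LinearMap.mulLeft ℂ P) ⊔ (homogeneousSubmodule (Fin 3) ℂ D).map (LinearMap.mulLeft ℂ Q)) +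
        D ^ 2 := h1.symm.trans h2.symm
  omega

/-! ### Normalisation of representatives -/

/-- **Normalisation.** A finite family of non-zero vectors of `ℂ³` can be rescaled so that the
first non-zero coordinate of each is `1`; common zeros of forms, pairwise non-proportionality and
the covering property are preserved. [folklore] -/
theorem exists_normalised {m : ℕ} (α : Fin m → (Fin 3 → ℂ)) (hα0 : ∀ i, α i ≠ 0) :
    ∃ (α' : Fin m → (Fin 3 → ℂ)) (piv : Fin m → Fin 3) (s : Fin m → ℂ),
      (∀ i, s i ≠ 0) ∧ (∀ i, α' i = s i • α i) ∧ (∀ i, α' i (piv i) = 1) ∧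
      (∀ i k, α' i k ≠ 0 → piv i ≤ k) := by
  classical
  have hex : ∀ i, ∃ k, α i k ≠ 0 := fun i => Function.ne_iff.mp (hα0 i)
  let piv : Fin m → Fin 3 := fun i => (univ.filter fun k => α i k ≠ 0).min'
    ((hex i).imp fun k hk => mem_filter.mpr ⟨mem_univ _, hk⟩)
  have hpiv : ∀ i, α i (piv i) ≠ 0 := fun i => by
    have h := Finset.min'_mem (univ.filter fun k => α i k ≠ 0)
      ((hex i).imp fun k hk => mem_filter.mpr ⟨mem_univ _, hk⟩)
    exact (mem_filter.mp h).2
  have hmin : ∀ i k, α i k ≠ 0 → piv i ≤ k := fun i k hk =>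
    Finset.min'_le (univ.filter fun k => α i k ≠ 0) k (mem_filter.mpr ⟨mem_univ _, hk⟩)
  refine ⟨fun i => (α i (piv i))⁻¹ • α i, piv, fun i => (α i (piv i))⁻¹,
    fun i => inv_ne_zero (hpiv i), fun i => rfl, fun i => ?_, fun i k hk => ?_⟩
  · simp [hpiv i]
  · apply hmin i k
    intro h0
    apply hk
    simp [h0]

/-- Rescaling preserves zeros of forms. [folklore] -/
theorem eval_smul_eq_zero_iff {P : CX} {D : ℕ} (hP : P.IsHomogeneous D) {s : ℂ} (hs : s ≠ 0)
    (x : Fin 3 → ℂ) : eval (s • x) P = 0 ↔ eval x P = 0 := by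
  have h : eval (s • x) P = s ^ D * eval x P := aeval_smul_of_isHomogeneous hP s x
  rw [h, mul_eq_zero, or_iff_right (pow_ne_zero _ hs)]

/-! ### Line forms are homogeneous -/

/-- `ℓ = X₀ − aX₁ − bX₂` is a form of degree `1`. [folklore] -/
theorem isHomogeneous_lineForm' (a b : ℂ) : (lineForm a b).IsHomogeneous 1 := by
  rw [lineForm]
  refine (isHomogeneous_X ℂ 0).sub ((?_ : (C a * X 1 : CX).IsHomogeneous 1).add ?_)
  · simpa using (isHomogeneous_C (Fin 3) a).mul (isHomogeneous_X ℂ 1)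
  · simpa using (isHomogeneous_C (Fin 3) b).mul (isHomogeneous_X ℂ 2)

/-! ### The package -/

/-- **The data attached to an integer form `P̃` of degree `D`** (see the module docstring): the
parameter `t` of `Q`, the data of `Φ`, the normalised representatives of `𝒵(P̃, Q)`, the
factorisation of `F = Φ(P̃, Q, ·)`, with all the properties the proof uses. (A record; nothing is
asserted — it is shown to be inhabited below.) [cite: Roy2013, §6, proof of Prop. 6.4; §7, Steps 2–3] -/
structure LevelPkg (D : ℕ) (Pt : MvPolynomial (Fin 3) ℤ) where
  /-- the parameter of `Q = ∑ tⁱ𝒟ⁱP̃` -/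
  t : ℕ
  /-- monomial complements -/
  M₁ : Finset (Fin 3 →₀ ℕ)
  /-- monomial complements -/
  M₂ : Finset (Fin 3 →₀ ℕ)
  /-- columns ↔ rows -/
  σ : PhiCol D M₁ M₂ ≃ PhiRow D
  /-- number of points of `𝒵(P̃, Q)` -/
  m : ℕ
  /-- normalised representatives -/
  α : Fin m → Fin 3 → ℂ
  /-- pivots -/
  piv : Fin m → Fin 3
  /-- leading constant of `F` -/
  c : ℂ
  /-- multiplicities -/
  e : Fin m → ℕ
  ht : t ≤ D ^ 2
  hQ0 : map (Int.castRingHom ℂ) (levelQ D Pt t) ≠ 0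
  hPQ : ∀ f : CX, map (Int.castRingHom ℂ) (levelQ D Pt t) * f ∈
    Ideal.span {map (Int.castRingHom ℂ) Pt} → f ∈ Ideal.span {map (Int.castRingHom ℂ) Pt}
  hM₁ : ∀ μ ∈ M₁, μ.degree = 2 * D
  hM₂ : ∀ μ ∈ M₂, μ.degree = 2 * D
  hE₁i : Submodule.span ℂ ((fun μ => monomial μ (1 : ℂ)) '' (M₁ : Set (Fin 3 →₀ ℕ))) ⊓
    (homogeneousSubmodule (Fin 3) ℂ D).map (LinearMap.mulLeft ℂ (map (Int.castRingHom ℂ) Pt)) = ⊥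
  hE₁s : Submodule.span ℂ ((fun μ => monomial μ (1 : ℂ)) '' (M₁ : Set (Fin 3 →₀ ℕ))) ⊔
    (homogeneousSubmodule (Fin 3) ℂ D).map (LinearMap.mulLeft ℂ (map (Int.castRingHom ℂ) Pt)) =
    homogeneousSubmodule (Fin 3) ℂ (2 * D)
  hE₂i : Submodule.span ℂ ((fun μ => monomial μ (1 : ℂ)) '' (M₂ : Set (Fin 3 →₀ ℕ))) ⊓
    ((homogeneousSubmodule (Fin 3) ℂ D).map (LinearMap.mulLeft ℂ (map (Int.castRingHom ℂ) Pt)) ⊔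
      (homogeneousSubmodule (Fin 3) ℂ D).map
        (LinearMap.mulLeft ℂ (map (Int.castRingHom ℂ) (levelQ D Pt t)))) = ⊥
  hE₂s : Submodule.span ℂ ((fun μ => monomial μ (1 : ℂ)) '' (M₂ : Set (Fin 3 →₀ ℕ))) ⊔
    ((homogeneousSubmodule (Fin 3) ℂ D).map (LinearMap.mulLeft ℂ (map (Int.castRingHom ℂ) Pt)) ⊔
      (homogeneousSubmodule (Fin 3) ℂ D).map
        (LinearMap.mulLeft ℂ (map (Int.castRingHom ℂ) (levelQ D Pt t)))) =
    homogeneousSubmodule (Fin 3) ℂ (2 * D)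
  hcard : M₂.card = D ^ 2
  hm : m ≤ D ^ 2
  piv_one : ∀ i, α i (piv i) = 1
  piv_min : ∀ i k, α i k ≠ 0 → piv i ≤ k
  zero : ∀ i, eval (α i) (map (Int.castRingHom ℂ) Pt) = 0 ∧
    eval (α i) (map (Int.castRingHom ℂ) (levelQ D Pt t)) = 0
  cov : ∀ β : Fin 3 → ℂ, β ≠ 0 → eval β (map (Int.castRingHom ℂ) Pt) = 0 →
    eval β (map (Int.castRingHom ℂ) (levelQ D Pt t)) = 0 → ∃ i, ∃ s : ℂ, β = s • α i
  sep : ∀ i j, i ≠ j → ¬∃ s : ℂ, α j = s • α i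
  alg : ∀ i k, IsAlgebraic ℚ (α i k)
  hc : c ≠ 0
  he1 : ∀ i, 1 ≤ e i
  hesum : ∑ i, e i = M₂.card
  hFeq : royF D M₁ M₂ σ (map (Int.castRingHom ℂ) Pt) (map (Int.castRingHom ℂ) (levelQ D Pt t)) =
    C c * ∏ i, evalForm D (α i) ^ e i
  hemax : ∀ i k, evalForm D (α i) ^ k ∣
    royF D M₁ M₂ σ (map (Int.castRingHom ℂ) Pt) (map (Int.castRingHom ℂ) (levelQ D Pt t)) → k ≤ e i

/-- **The package exists** for every integer form `P̃` of degree `D ≥ 1` with `X₀ ∤ P̃`, `X₂ ∤ P̃`.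
[cite: Roy2013, §6, proof of Prop. 6.4; §7, Steps 2–3] -/
theorem nonempty_levelPkg {D : ℕ} (hD : 1 ≤ D) {Pt : MvPolynomial (Fin 3) ℤ}
    (hPt : (map (Int.castRingHom ℂ) Pt).IsHomogeneous D) (hPt0 : map (Int.castRingHom ℂ) Pt ≠ 0)
    (hX0 : ¬(X 0 : CX) ∣ map (Int.castRingHom ℂ) Pt) (hX2 : ¬(X 2 : CX) ∣ map (Int.castRingHom ℂ) Pt) :
    Nonempty (LevelPkg D Pt) := by
  classical
  set P : CX := map (Int.castRingHom ℂ) Pt with hPdef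
  -- the companion `Q`
  obtain ⟨t, ht, hrel⟩ := exists_coprime_deriv_combination hPt hPt0 hX0 hX2
  set Q : CX := map (Int.castRingHom ℂ) (levelQ D Pt t) with hQdef
  have hQeq : Q = ∑ i ∈ Icc 1 D, ((t : ℂ) ^ i) • homD^[i] P := map_levelQ D Pt t
  rw [← hQeq] at hrel
  have hQ : Q.IsHomogeneous D := isHomogeneous_map_levelQ hPt t
  have hPQ : ∀ f : CX, Q * f ∈ Ideal.span {P} → f ∈ Ideal.span {P} := by
    intro f hf
    rw [Ideal.mem_span_singleton] at hf ⊢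
    exact hrel.dvd_of_dvd_mul_left hf
  have hQ0 : Q ≠ 0 := by
    intro h0
    rw [h0] at hrel
    have hu : IsUnit P := isRelPrime_zero_right.mp hrel
    have h1 : P.totalDegree = 0 := by
      obtain ⟨u, hu'⟩ := hu
      have h2 := congrArg totalDegree (u.mul_inv)
      rw [totalDegree_mul_of_isDomain (Units.ne_zero u) (Units.ne_zero u⁻¹), totalDegree_one] at h2
      rw [← hu']; omega
    rw [hPt.totalDegree hPt0] at h1
    omega
  -- the data of `Φ`
  obtain ⟨a, b, hab, hreg⟩ := exists_regular_lineForm_pow hPt hQ hD hPt0 hQ0 hPQ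
  have hR : (lineForm a b ^ D).IsHomogeneous D := by
    simpa using (isHomogeneous_lineForm' a b).pow D
  obtain ⟨M₁, M₂, hM₁, hM₂, hE₁i, hE₁s, hE₂i, hE₂s, ⟨σ⟩⟩ :=
    exists_phi_data hPt hQ hR hPt0 hQ0 hPQ (hreg D)
  have hcard : M₂.card = D ^ 2 := card_eq_sq hPt hQ hPt0 hQ0 hPQ hE₂i hE₂s
  -- the representatives, normalised
  obtain ⟨m, α₀, hm, hα₀0, hz₀, hsep₀, hcov₀⟩ := exists_common_zero_reprs hPt hQ hPt0 hQ0 hPQ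
  obtain ⟨α, piv, s, hs, hαs, hpiv1, hpivmin⟩ := exists_normalised α₀ hα₀0
  have hα0 : ∀ i, α i ≠ 0 := fun i h => by
    have := hpiv1 i; rw [h, Pi.zero_apply] at this; exact zero_ne_one this
  have hz : ∀ i, eval (α i) P = 0 ∧ eval (α i) Q = 0 := fun i => by
    rw [hαs i, eval_smul_eq_zero_iff hPt (hs i), eval_smul_eq_zero_iff hQ (hs i)]
    exact hz₀ i
  have hsep : ∀ i j, i ≠ j → ¬∃ r : ℂ, α j = r • α i := by
    rintro i j hij ⟨r, hr⟩
    refine hsep₀ i j hij ⟨(s j)⁻¹ * r * s i, ?_⟩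
    have h1 : α₀ j = (s j)⁻¹ • α j := by
      rw [hαs j, smul_smul, inv_mul_cancel₀ (hs j), one_smul]
    rw [h1, hr, hαs i, smul_smul, smul_smul]
  have hcov : ∀ β : Fin 3 → ℂ, β ≠ 0 → eval β P = 0 → eval β Q = 0 → ∃ i, ∃ r : ℂ, β = r • α i := by
    intro β hβ hβP hβQ
    obtain ⟨i, r, hr⟩ := hcov₀ β hβ hβP hβQ
    refine ⟨i, r * (s i)⁻¹, ?_⟩
    rw [hr, hαs i, smul_smul, mul_assoc, inv_mul_cancel₀ (hs i), mul_one]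
  -- algebraicity of the coordinates
  have halg : ∀ i k, IsAlgebraic ℚ (α i k) := by
    intro i k
    have hPq : (map (Int.castRingHom ℚ) Pt).IsHomogeneous D := isHomogeneous_map_rat hPt
    have hQq : (map (Int.castRingHom ℚ) (levelQ D Pt t)).IsHomogeneous D := isHomogeneous_map_rat hQ
    have h1 : α i k = α₀ i k / α₀ i (piv i) := by
      have hpk : α i (piv i) = 1 := hpiv1 i
      rw [hαs i] at hpk ⊢
      simp only [Pi.smul_apply, smul_eq_mul] at hpk ⊢
      have : s i = (α₀ i (piv i))⁻¹ := eq_inv_of_mul_eq_one_left hpk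
      rw [this, inv_mul_eq_div]
    rw [h1]
    refine isAlgebraic_ratio_of_common_zero hPq hQq (by rw [toCX_map_int]; exact hPt0)
      (by rw [toCX_map_int]; exact hQ0) (by rw [toCX_map_int, toCX_map_int]; exact hPQ)
      (by rw [toCX_map_int]; exact (hz₀ i).1) (by rw [toCX_map_int]; exact (hz₀ i).2) ?_ k
    intro h0
    have hpk : α i (piv i) = 1 := hpiv1 i
    rw [hαs i, Pi.smul_apply, smul_eq_mul, h0, mul_zero] at hpk
    exact zero_ne_one hpk
  -- the factorisation
  obtain ⟨c, e, hc, he1, hesum, hFeq, hemax⟩ := royF_eq_C_mul_prod hPt hQ hD hPt0 hQ0 hPQ hM₁ hM₂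
    hE₁i hE₁s hE₂i hE₂s σ α hα0 hz hsep hcov
  exact ⟨⟨t, M₁, M₂, σ, m, α, piv, c, e, ht, hQ0, hPQ, hM₁, hM₂, hE₁i, hE₁s, hE₂i, hE₂s, hcard, hm,
    hpiv1, hpivmin, hz, hcov, hsep, halg, hc, he1, hesum, hFeq, hemax⟩⟩

namespace LevelPkg

variable {D : ℕ} {Pt : MvPolynomial (Fin 3) ℤ} (L : LevelPkg D Pt)

/-- The complex forms `P̃`, `Q`. [folklore] -/
abbrev Pc : CX := map (Int.castRingHom ℂ) Pt

/-- The complex forms `P̃`, `Q`. [folklore] -/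
abbrev Qc : CX := map (Int.castRingHom ℂ) (levelQ D Pt L.t)

/-- The representatives are non-zero. [folklore] -/
theorem α_ne_zero (i : Fin L.m) : L.α i ≠ 0 := fun h => by
  have := L.piv_one i; rw [h, Pi.zero_apply] at this; exact zero_ne_one this

/-- There is at least one point (`∑ e_i = D² ≥ 1`). [folklore] -/
theorem m_pos (hD : 1 ≤ D) : 0 < L.m := by
  by_contra h0
  push Not at h0
  have hm0 : L.m = 0 := Nat.le_zero.mp h0
  have h1 : ∑ i, L.e i = 0 := by
    have : IsEmpty (Fin L.m) := by rw [hm0]; infer_instance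
    exact Finset.sum_of_isEmpty _
  rw [L.hesum, L.hcard] at h1
  exact absurd h1 (pow_ne_zero 2 (by omega))

/-- **The induced configuration over a field `K` containing the coordinates.**
[cite: Roy2013, §6, proof of Prop. 6.4] -/
def cfg (K : IntermediateField ℚ ℂ) (hK : ∀ i k, L.α i k ∈ K) : ZeroConfigK K (Fin L.m) where
  α := L.α
  piv := L.piv
  P := map (Int.castRingHom ℚ) Pt
  Q := map (Int.castRingHom ℚ) (levelQ D Pt L.t)
  piv_one := L.piv_one
  piv_min := L.piv_min
  mem := hK
  zero i := by rw [toCX_map_int, toCX_map_int]; exact L.zero i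
  cov β hβ hP hQ := by
    rw [toCX_map_int] at hP hQ
    exact L.cov β hβ hP hQ
  sep := L.sep

/-- The configuration has the representatives of the package. [folklore] -/
@[simp] theorem cfg_α (K : IntermediateField ℚ ℂ) (hK : ∀ i k, L.α i k ∈ K) : (L.cfg K hK).α = L.α := rfl

/-- All coordinates lie in the closure field of any finite set containing them. [folklore] -/
theorem mem_closureField_of_subset {S : Finset ℂ} (hS : ∀ x ∈ S, IsAlgebraic ℚ x)
    (hsub : ∀ i k, L.α i k ∈ S) (i : Fin L.m) (k : Fin 3) : L.α i k ∈ closureField S :=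
  mem_closureField hS (hsub i k)

/-- The finite set of all coordinates of the package. [folklore] -/
def coords : Finset ℂ := univ.image fun p : Fin L.m × Fin 3 => L.α p.1 p.2

/-- Coordinates belong to `coords`. [folklore] -/
theorem mem_coords (i : Fin L.m) (k : Fin 3) : L.α i k ∈ L.coords :=
  mem_image.mpr ⟨(i, k), mem_univ _, rfl⟩

/-- `coords` consists of algebraic numbers. [folklore] -/
theorem isAlgebraic_of_mem_coords {x : ℂ} (hx : x ∈ L.coords) : IsAlgebraic ℚ x := by
  obtain ⟨p, -, rfl⟩ := mem_image.mp hx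
  exact L.alg p.1 p.2

end LevelPkg

end Roy2013

end Literature.NumberTheory.Transcendental
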